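import Mathlib.LinearAlgebra.LinearIndependent.Basic
import Mathlib.Algebra.Group.Hom.Instances
import Mathlib.Algebra.BigOperators.Group.Finset.Basic
import Mathlib.Data.Complex.Basic
import Mathlib.GroupTheory.QuotientGroup.Basic
import HarnessLib

/-!
# F0 · P3c · line LH6 «StCharTS» — road (D) «DEEP-FL», brick F3a «CHAR-SEPARATION ⇒ FOURIER UNIQUENESS» (discrete, generic): a finitely supported
# function on a commutative group whose character sums all vanish is zero, as soon as characters separate the support (Dedekind–Artin on the dual group)

Cell `pub/hodgecm-mathlib`, crux H413 = `stmt-HodgeConjecture-24833` (`--supports` lane, helper), route HCCMUnconditional; seat LH6-p04 (g2), road (D) «DEEP-FL»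
(owner), interface v2 `F0/P3b/LH6-p04/g2/ROAD-D.interface.v2.txt` brick F3 «TORUS-FOURIER-UNIQ», abstract half (the concrete half F3b = «characters of
`M/(M ∩ K_N)` separate points» is separate).  THEOREMS ONLY (generic: any commutative group; Mathlib only), sorry-free, no definition ∕ instance ∕ notation ∕
named fact.  HONEST LABEL: HC_CM is proved only modulo the 7 printed citations (2 remaining: hLiu418 = stmt-HodgeConjecture-24832, h413 =
stmt-HodgeConjecture-24833) until rung 0 closes; count-neutral; elementary algebra here.

WHY (road (D), D3 «MATCH» at the split classes): the two sides of the transfer identity, read on the split torus `T = M`, are `T ∩ K_N`-invariant compactly supported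
functions whose integrals against EVERY character are known (★ orbital forms `tr i(χ)(f) = c·∫_T χδ^{1/2}J⁻¹O_t(f)` + ★ R2d); equality of the functions then follows
from uniqueness of such «Fourier coefficients» on the discrete group `A = T/(T ∩ K_N)` — this file's statement, with the separation hypothesis discharged by F3b.

THE MATHEMATICS (folklore; Dedekind–Artin [Mathlib `linearIndependent_monoidHom`] applied to the DUAL group).
* `eval_injOn_of_separates` — if characters `A →* ℂˣ` separate the points of `S`, the evaluation characters `ev_s : (A →* ℂˣ) →* ℂ`, `s ∈ S`, are pairwise distinct.
* **`eq_zero_of_forall_sum_mul_char_eq_zero`** — `S ⊆ A` finite, characters separate `S`, `D : A → ℂ` with `Σ_{s ∈ S} D(s) χ(s) = 0` for every `χ : A →* ℂˣ`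
  ⟹ `D(s) = 0` for all `s ∈ S` (the `ev_s` are linearly independent functions on the dual group).
* `eq_of_forall_sum_mul_char_eq` — the same for two coefficient functions.
* `eq_zero_of_forall_sum_mul_char_eq_zero_quotient` — the form used on a torus: `C ≤ T` (any commutative `T`), `S ⊆ T` finite with characters of `T` TRIVIAL ON `C`
  separating the classes `s C` (`s ∈ S` pairwise inequivalent mod `C`): `Σ_{s∈S} D(s) χ(s) = 0` for all `χ` with `C ≤ ker χ` ⟹ `D = 0` on `S`.

## References
* [ConradLinearChar] K. Conrad, *Linear independence of characters* (the note cited by Mathlib's `linearIndependent_monoidHom`); E. Artin, *Galois Theory* (1944), Thm. 12.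
* [Rogawski1990] J. D. Rogawski, *Automorphic Representations of Unitary Groups in Three Variables* (1990), §12.7 p. 193 (Fourier analysis on `M ≅ E^*`:
  «`φ̂(χ) = Σ φ(ωⁿ)χ(ω)ⁿ`»).
-/

set_option autoImplicit false
-- the mandated namespace has the single-problem summit's repeated segment (`HodgeConjecture.HodgeConjecture`)
set_option linter.dupNamespace false

open scoped BigOperators

namespace Summit.HodgeConjecture.HodgeConjecture.Cruxes.H413.F0P3cStCharTSCharSeparation

variable {A : Type*} [CommGroup A]

/-- The evaluation character `ev_a : (A →* ℂˣ) →* ℂ`, `χ ↦ χ(a)` (a monoid hom on the dual group, valued in `ℂ`). [folklore] -/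
theorem eval_apply_coe (a : A) (χ : A →* ℂˣ) :
    ((Units.coeHom ℂ).comp (MonoidHom.eval a) : (A →* ℂˣ) →* ℂ) χ = (χ a : ℂ) := rfl

/-- If characters separate the points of `S`, the evaluation characters `ev_s`, `s ∈ S`, are pairwise distinct. [folklore] -/
theorem eval_injOn_of_separates (S : Finset A) (hsep : ∀ a ∈ S, ∀ a' ∈ S, a ≠ a' → ∃ χ : A →* ℂˣ, χ a ≠ χ a') :
    Set.InjOn (fun a : A => ((Units.coeHom ℂ).comp (MonoidHom.eval a) : (A →* ℂˣ) →* ℂ)) (S : Set A) := by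
  intro a ha a' ha' h
  by_contra hne
  obtain ⟨χ, hχ⟩ := hsep a ha a' ha' hne
  have := congrArg (fun f : (A →* ℂˣ) →* ℂ => f χ) h
  simp only [eval_apply_coe] at this
  exact hχ (Units.val_injective this)

/-- **FOURIER UNIQUENESS FROM CHARACTER SEPARATION (discrete).**  `S ⊆ A` finite, characters of `A` separate the points of `S`, and `D : A → ℂ` with
`Σ_{s∈S} D(s)·χ(s) = 0` for EVERY character `χ : A →* ℂˣ`.  Then `D(s) = 0` for every `s ∈ S` — Dedekind–Artin independence of the characters `ev_s` of the dual
group (Mathlib `linearIndependent_monoidHom`). [folklore] [cite: Rogawski1990, §12.7 p. 193] -/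
theorem eq_zero_of_forall_sum_mul_char_eq_zero (S : Finset A) (hsep : ∀ a ∈ S, ∀ a' ∈ S, a ≠ a' → ∃ χ : A →* ℂˣ, χ a ≠ χ a')
    (D : A → ℂ) (h : ∀ χ : A →* ℂˣ, ∑ s ∈ S, D s * (χ s : ℂ) = 0) : ∀ s ∈ S, D s = 0 := by
  classical
  -- Dedekind–Artin on the dual group `G = (A →* ℂˣ)`, restricted to the injective subfamily `s ↦ ev_s`, `s ∈ S`
  have hLI := linearIndependent_monoidHom (A →* ℂˣ) ℂ
  have hinj : Function.Injective (fun s : ↥S => ((Units.coeHom ℂ).comp (MonoidHom.eval (s : A)) : (A →* ℂˣ) →* ℂ)) := by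
    intro s s' hss'
    exact Subtype.ext (eval_injOn_of_separates S hsep s.2 s'.2 hss')
  have hLI' := hLI.comp _ hinj
  rw [linearIndependent_iff'] at hLI'
  have hsum : ∑ s : ↥S, D (s : A) • (fun f : (A →* ℂˣ) →* ℂ => (f : (A →* ℂˣ) → ℂ))
      ((fun s : ↥S => ((Units.coeHom ℂ).comp (MonoidHom.eval (s : A)) : (A →* ℂˣ) →* ℂ)) s) = 0 := by
    funext χ
    simp only [Finset.sum_apply, Pi.smul_apply, smul_eq_mul, Pi.zero_apply]
    have := h χ
    rw [← Finset.sum_coe_sort S] at this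
    simpa only [eval_apply_coe] using this
  intro s hs
  exact hLI' Finset.univ (fun s : ↥S => D (s : A)) hsum ⟨s, hs⟩ (Finset.mem_univ _)

/-- Two coefficient functions with the same character sums on `S` (characters separating `S`) agree on `S`. [folklore] -/
theorem eq_of_forall_sum_mul_char_eq (S : Finset A) (hsep : ∀ a ∈ S, ∀ a' ∈ S, a ≠ a' → ∃ χ : A →* ℂˣ, χ a ≠ χ a')
    (D D' : A → ℂ) (h : ∀ χ : A →* ℂˣ, ∑ s ∈ S, D s * (χ s : ℂ) = ∑ s ∈ S, D' s * (χ s : ℂ)) : ∀ s ∈ S, D s = D' s := by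
  have h0 := eq_zero_of_forall_sum_mul_char_eq_zero S hsep (fun a => D a - D' a) (fun χ => by
    simp only [sub_mul, Finset.sum_sub_distrib, h χ, sub_self])
  intro s hs
  exact sub_eq_zero.1 (h0 s hs)

/-- **The torus form** (characters trivial on a subgroup).  `T` commutative, `C ≤ T`, `S ⊆ T` finite; suppose the characters of `T` that are TRIVIAL ON `C` separate the
elements of `S` (in particular the `s ∈ S` are pairwise inequivalent mod `C`), and `Σ_{s∈S} D(s)·χ(s) = 0` for every such character.  Then `D = 0` on `S` — apply the
discrete statement on `A = T ⧸ C` (characters of `T ⧸ C` = characters of `T` trivial on `C`, `QuotientGroup.lift`). [folklore] [cite: Rogawski1990, §12.7 p. 193] -/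
theorem eq_zero_of_forall_sum_mul_char_eq_zero_quotient {T : Type*} [CommGroup T] (C : Subgroup T) (S : Finset T)
    (hsep : ∀ a ∈ S, ∀ a' ∈ S, a ≠ a' → ∃ χ : T →* ℂˣ, C ≤ χ.ker ∧ χ a ≠ χ a')
    (D : T → ℂ) (h : ∀ χ : T →* ℂˣ, C ≤ χ.ker → ∑ s ∈ S, D s * (χ s : ℂ) = 0) : ∀ s ∈ S, D s = 0 := by
  classical
  -- pass to `A = T ⧸ C`; the classes of `S` are pairwise distinct (separated), so `D` descends along `S`
  have hinjS : Set.InjOn (QuotientGroup.mk (s := C) : T → T ⧸ C) (S : Set T) := by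
    intro a ha a' ha' hq
    by_contra hne
    obtain ⟨χ, hχC, hχ⟩ := hsep a ha a' ha' hne
    apply hχ
    have hlift : ∀ t : T, QuotientGroup.lift C χ hχC (QuotientGroup.mk t) = χ t := fun t => QuotientGroup.lift_mk C hχC t
    rw [← hlift a, ← hlift a', hq]
  -- the descended coefficient function on the image
  let D' : T ⧸ C → ℂ := fun q => ∑ s ∈ S with QuotientGroup.mk (s := C) s = q, D s
  have hD' : ∀ s ∈ S, D' (QuotientGroup.mk s) = D s := by
    intro s hs
    simp only [D']
    exact Finset.sum_eq_single_of_mem s (Finset.mem_filter.2 ⟨hs, rfl⟩)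
      (fun b hb hbs => absurd (hinjS (Finset.mem_filter.1 hb).1 hs (Finset.mem_filter.1 hb).2) hbs)
  have hsep' : ∀ q ∈ S.image (QuotientGroup.mk (s := C)), ∀ q' ∈ S.image (QuotientGroup.mk (s := C)), q ≠ q' →
      ∃ χ : T ⧸ C →* ℂˣ, χ q ≠ χ q' := by
    intro q hq q' hq' hne
    obtain ⟨a, ha, rfl⟩ := Finset.mem_image.1 hq
    obtain ⟨a', ha', rfl⟩ := Finset.mem_image.1 hq'
    have hne' : a ≠ a' := fun h => hne (by rw [h])
    obtain ⟨χ, hχC, hχ⟩ := hsep a ha a' ha' hne'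
    refine ⟨QuotientGroup.lift C χ hχC, ?_⟩
    rwa [QuotientGroup.lift_mk, QuotientGroup.lift_mk]
  have h' : ∀ χ : T ⧸ C →* ℂˣ, ∑ q ∈ S.image (QuotientGroup.mk (s := C)), D' q * (χ q : ℂ) = 0 := by
    intro χ
    rw [Finset.sum_image hinjS]
    have hker : C ≤ (χ.comp (QuotientGroup.mk' C)).ker := by
      intro c hc
      rw [MonoidHom.mem_ker, MonoidHom.comp_apply, QuotientGroup.mk'_apply, (QuotientGroup.eq_one_iff c).2 hc, map_one]
    have := h (χ.comp (QuotientGroup.mk' C)) hker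
    refine (Finset.sum_congr rfl fun s hs => ?_).trans this
    rw [hD' s hs, MonoidHom.comp_apply, QuotientGroup.mk'_apply]
  intro s hs
  rw [← hD' s hs]
  exact eq_zero_of_forall_sum_mul_char_eq_zero _ hsep' D' h' _ (Finset.mem_image_of_mem _ hs)

end Summit.HodgeConjecture.HodgeConjecture.Cruxes.H413.F0P3cStCharTSCharSeparation
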